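import Summits.Ventures.DiscreteObjects.UnitDistance.KernelRupAdjCnf
import HarnessLib

/-!
# A lighter kernel RUP certificate format: quaternary clause trie, kernel-primitive arithmetic, linear CNF (`KRup.checkAllQ`)

Framing (verbatim for the cell): lottery ticket; floor = certified bounds/negative ranges.

Cell `pub-namedobj`, target (U), seat udg g18.  `KernelRupCheck.lean` (udg g12) re-plays CDCL refutations in the kernel
(`KRup.checkAll`); its cost per piece is what bounded the witnesses of the quadratic table to `≈ 1,100` vertices (udg g16:
the 2,005-vertex witness over `ℚ(√287)` could not be checked).  Measured by this seat: (i) `KRup.cnfOfAdj adj n v₀ v₁` reads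
`adj.getD v []` for every `v < n` — `Θ(n²)` kernel steps, alone `> 5 GB` of kernel memory at `n = 2005`; (ii) every hint of a RUP
step costs `≈ 16` levels of the binary trie `Store`, each through `if … then … else` on `Decidable` instances, and the clause scan
goes through `Nat.testBit` / `!=` / instance chains — several hundred kernel steps (and cache entries) per hint.  This file is a
second checker with the SAME semantics and the same soundness statement, written for the kernel: a 4-ary trie `QStore` (half the
levels), every test a kernel-accelerated `Nat.beq / Nat.land / Nat.shiftRight / Nat.lor / Nat.pow` on literals, branching by
`Bool.rec` (one ι-step), recursion by the recursors themselves, the set of currently FALSIFIED literals as one bit-set `F : ℕ`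
(so the scan of a clause tests `F` at the literal itself), and (in `KernelRupQuadCnf.lean`) a one-pass CNF `cnfOfAdjLin`.  Encoding of literals / clauses / steps is unchanged (`KernelRupCheck.lean`,
`KernelRupColouring.lean`): literal `l` has variable `l / 2` and polarity `l % 2`; a step is `(C, hints)`.
SOUNDNESS (`checkAllQ_sound`, `checkAllQ_refutes`): if every clause of the store is true under `σ` then every checked clause is
true under `σ`; a checked empty clause refutes `σ` — so `KRup.all_true_of_valid` (`KernelRupColouring.lean`) applies verbatim to
runs on stores of admissible clauses.  No statement about any graph is made here.
-/

namespace Summit.Ventures.DiscreteObjects.UnitDistance.KRup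

/-! ## Bit sets of literals -/

/-- Bit `k` of `F`, with kernel-accelerated primitives only. -/
def tb (F k : ℕ) : Bool := Nat.beq (Nat.land (Nat.shiftRight F k) 1) 1

/-- `tb` is `Nat.testBit`. -/
theorem tb_eq_testBit (F k : ℕ) : tb F k = Nat.testBit F k := by
  have h1 : Nat.land (Nat.shiftRight F k) 1 = (F >>> k) % 2 := Nat.and_one_is_mod _
  have h2 : Nat.testBit F k = decide ((F >>> k) % 2 = 1) := by
    rw [Nat.testBit_eq_decide_div_mod_eq, Nat.shiftRight_eq_div_pow]
  rw [h2]
  unfold tb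
  rw [h1]
  rcases Nat.mod_two_eq_zero_or_one (F >>> k) with h | h <;> rw [h] <;> rfl

/-- The complementary literal, kernel-primitive form of `KRup.neg`. -/
def negQ (l : ℕ) : ℕ := Bool.rec (l - 1) (l + 1) (Nat.beq (Nat.land l 1) 0)

/-- `negQ = neg`. -/
theorem negQ_eq_neg (l : ℕ) : negQ l = neg l := by
  have h : Nat.land l 1 = l % 2 := Nat.and_one_is_mod _
  unfold negQ neg
  rw [h]
  by_cases h0 : l % 2 = 0
  · rw [h0, if_pos rfl]; rfl
  · have h1 : l % 2 = 1 := by omega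
    rw [h1, if_neg (by decide)]; rfl

/-- The bit set of the literals of `C` (all of them FALSE when the negation of `C` is assumed). -/
noncomputable def assumeQ (C : List ℕ) : ℕ :=
  List.rec (motive := fun _ => ℕ) 0 (fun l _ r => Nat.lor r (Nat.pow 2 l)) C

/-! ## Quaternary clause trie -/

/-- 4-ary trie of clauses: a node holds the clause with key `0` and four sub-tries for the keys `≡ 0, 1, 2, 3 (mod 4)`
(sub-key `k / 4`). -/
inductive QStore where
  | nil : QStore
  | node : Option (List ℕ) → QStore → QStore → QStore → QStore → QStore

/-- Lookup by key (recursor form; `≈ 9` levels for `6 · 10⁴` ids). -/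
noncomputable def QStore.get (t : QStore) : ℕ → Option (List ℕ) :=
  QStore.rec (motive := fun _ => ℕ → Option (List ℕ)) (fun _ => none)
    (fun v _ _ _ _ g0 g1 g2 g3 k =>
      Bool.rec
        (let r := Nat.land k 3
         let q := Nat.shiftRight k 2
         Bool.rec (Bool.rec (Bool.rec (g3 q) (g2 q) (Nat.beq r 2)) (g1 q) (Nat.beq r 1)) (g0 q) (Nat.beq r 0))
        v (Nat.beq k 0)) t

/-- One insertion level: put `C` at key `k` of the node with fields `v, c0 … c3`, recursing with `ih` into one child. -/
noncomputable def QStore.insNode (ih : QStore → ℕ → List ℕ → QStore) (v : Option (List ℕ)) (c0 c1 c2 c3 : QStore)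
    (k : ℕ) (C : List ℕ) : QStore :=
  Bool.rec
    (let r := Nat.land k 3
     let q := Nat.shiftRight k 2
     Bool.rec (Bool.rec (Bool.rec (.node v c0 c1 c2 (ih c3 q C)) (.node v c0 c1 (ih c2 q C) c3) (Nat.beq r 2))
       (.node v c0 (ih c1 q C) c2 c3) (Nat.beq r 1)) (.node v (ih c0 q C) c1 c2 c3) (Nat.beq r 0))
    (.node (some C) c0 c1 c2 c3) (Nat.beq k 0)

/-- Insert clause `C` at key `k` (`d` = depth fuel ≥ number of base-4 digits of `k`). -/
noncomputable def QStore.ins (d : ℕ) : QStore → ℕ → List ℕ → QStore :=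
  Nat.rec (motive := fun _ => QStore → ℕ → List ℕ → QStore) (fun t _ _ => t)
    (fun _ ih t k C => QStore.casesOn (motive := fun _ => QStore) t
      (QStore.insNode ih none .nil .nil .nil .nil k C)
      (fun v c0 c1 c2 c3 => QStore.insNode ih v c0 c1 c2 c3 k C)) d

/-- Insert a list of clauses with consecutive keys starting at `i`. -/
noncomputable def QStore.insList (d : ℕ) (t : QStore) (i : ℕ) (L : List (List ℕ)) : QStore :=
  List.rec (motive := fun _ => QStore → ℕ → QStore) (fun t _ => t)
    (fun C _ ih t i => ih (t.ins d i C) (i + 1)) L t i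

/-- The store of a clause list with keys `1, 2, …`. -/
noncomputable def QStore.ofList (d : ℕ) (L : List (List ℕ)) : QStore := QStore.insList d .nil 1 L

/-- Every clause stored in `t` satisfies `P`. -/
def QStore.All (P : List ℕ → Prop) : QStore → Prop
  | .nil => True
  | .node v c0 c1 c2 c3 => (∀ C, v = some C → P C) ∧ c0.All P ∧ c1.All P ∧ c2.All P ∧ c3.All P

/-- A clause fetched from a store all of whose clauses satisfy `P` satisfies `P` (the indexing is irrelevant). -/
theorem QStore.All.get {P : List ℕ → Prop} : ∀ {t : QStore}, t.All P → ∀ {k : ℕ} {C : List ℕ}, t.get k = some C → P C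
  | .nil, _, k, C, h => by simp [QStore.get] at h
  | .node v c0 c1 c2 c3, ⟨hv, h0, h1, h2, h3⟩, k, C, h => by
      revert h
      change (Bool.rec (Bool.rec (Bool.rec (Bool.rec (c3.get (Nat.shiftRight k 2)) (c2.get (Nat.shiftRight k 2))
        (Nat.beq (Nat.land k 3) 2)) (c1.get (Nat.shiftRight k 2)) (Nat.beq (Nat.land k 3) 1))
        (c0.get (Nat.shiftRight k 2)) (Nat.beq (Nat.land k 3) 0)) v (Nat.beq k 0) : Option (List ℕ)) = some C → P C
      cases Nat.beq k 0 <;> cases Nat.beq (Nat.land k 3) 0 <;> cases Nat.beq (Nat.land k 3) 1 <;>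
        cases Nat.beq (Nat.land k 3) 2 <;> intro h
      all_goals first
        | exact hv C h
        | exact QStore.All.get h0 h
        | exact QStore.All.get h1 h
        | exact QStore.All.get h2 h
        | exact QStore.All.get h3 h

/-- The empty store satisfies every predicate. -/
theorem QStore.All_nil (P : List ℕ → Prop) : QStore.All P .nil := trivial

/-- One insertion level preserves `All P`. -/
theorem QStore.All.insNode {P : List ℕ → Prop} {C : List ℕ} (hC : P C) {ih : QStore → ℕ → List ℕ → QStore}
    (hih : ∀ t k, t.All P → (ih t k C).All P) {v : Option (List ℕ)} {c0 c1 c2 c3 : QStore}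
    (hv : ∀ C', v = some C' → P C') (h0 : c0.All P) (h1 : c1.All P) (h2 : c2.All P) (h3 : c3.All P) (k : ℕ) :
    (QStore.insNode ih v c0 c1 c2 c3 k C).All P := by
  unfold QStore.insNode
  cases Nat.beq k 0
  · change (Bool.rec (Bool.rec (Bool.rec (QStore.node v c0 c1 c2 (ih c3 (Nat.shiftRight k 2) C))
      (QStore.node v c0 c1 (ih c2 (Nat.shiftRight k 2) C) c3) (Nat.beq (Nat.land k 3) 2))
      (QStore.node v c0 (ih c1 (Nat.shiftRight k 2) C) c2 c3) (Nat.beq (Nat.land k 3) 1))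
      (QStore.node v (ih c0 (Nat.shiftRight k 2) C) c1 c2 c3) (Nat.beq (Nat.land k 3) 0) : QStore).All P
    cases Nat.beq (Nat.land k 3) 0
    · cases Nat.beq (Nat.land k 3) 1
      · cases Nat.beq (Nat.land k 3) 2
        · exact ⟨hv, h0, h1, h2, hih _ _ h3⟩
        · exact ⟨hv, h0, h1, hih _ _ h2, h3⟩
      · exact ⟨hv, h0, hih _ _ h1, h2, h3⟩
    · exact ⟨hv, hih _ _ h0, h1, h2, h3⟩
  · exact ⟨fun C' h => by simp only [Option.some.injEq] at h; exact h ▸ hC, h0, h1, h2, h3⟩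

/-- Inserting a clause satisfying `P` preserves `All P`. -/
theorem QStore.All.ins {P : List ℕ → Prop} {C : List ℕ} (hC : P C) :
    ∀ (d : ℕ) (t : QStore), t.All P → ∀ (k : ℕ), (t.ins d k C).All P
  | 0, t, ht, k => ht
  | d + 1, .nil, _, k =>
      QStore.All.insNode hC (fun t k ht => QStore.All.ins hC d t ht k) (fun C' h => by simp at h)
        (QStore.All_nil P) (QStore.All_nil P) (QStore.All_nil P) (QStore.All_nil P) k
  | d + 1, .node v c0 c1 c2 c3, ⟨hv, h0, h1, h2, h3⟩, k =>
      QStore.All.insNode hC (fun t k ht => QStore.All.ins hC d t ht k) hv h0 h1 h2 h3 k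

/-- Inserting a list of clauses satisfying `P` preserves `All P`. -/
theorem QStore.All.insList {P : List ℕ → Prop} (d : ℕ) :
    ∀ {L : List (List ℕ)} {t : QStore} (i : ℕ), t.All P → (∀ C ∈ L, P C) → (t.insList d i L).All P
  | [], t, i, ht, _ => ht
  | C :: rest, t, i, ht, hL =>
      QStore.All.insList d (L := rest) (i + 1) (QStore.All.ins (hL C (by simp)) d t ht i)
        fun C' hC' => hL C' (by simp [hC'])

/-- The store of a list of clauses satisfying `P` satisfies `All P`. -/
theorem QStore.All.ofList {P : List ℕ → Prop} (d : ℕ) {L : List (List ℕ)} (hL : ∀ C ∈ L, P C) :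
    (QStore.ofList d L).All P :=
  QStore.All.insList d 1 (QStore.All_nil _) hL

/-! ## The RUP check on the falsified-literal set -/

/-- Scan clause `D` under the falsified-literal set `F`: `0` if every literal is falsified (conflict), `u + 2` if exactly one
literal `u` is not falsified (unit), `1` if at least two are not falsified. -/
noncomputable def scanQ (F : ℕ) (D : List ℕ) : ℕ :=
  List.rec (motive := fun _ => ℕ) 0 (fun l _ r => Bool.rec (Bool.rec 1 (l + 2) (Nat.beq r 0)) r (tb F l)) D

/-- Follow the hints: each hinted clause must be unit (its free literal becomes true, i.e. the complement is falsified) until a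
hinted clause is falsified (success).  `f` = fuel. -/
noncomputable def rupQ (S : QStore) (f : ℕ) : ℕ → List ℕ → Bool :=
  Nat.rec (motive := fun _ => ℕ → List ℕ → Bool) (fun _ _ => false)
    (fun _ ih F hs =>
      List.casesOn (motive := fun _ => Bool) hs false fun h hs' =>
        Option.casesOn (motive := fun _ => Bool) (S.get h) false fun D =>
          (let r := scanQ F D
           Bool.rec (Bool.rec (ih (Nat.lor F (Nat.pow 2 (negQ (r - 2)))) hs') false (Nat.beq r 1)) true (Nat.beq r 0)))
    f

/-- Check the steps `(C, hints)` in order against the store, inserting each checked clause at the keys `i, i + 1, …`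
(`f` = hint fuel, `d` = trie depth fuel). -/
noncomputable def checkAllQ (f d : ℕ) (S : QStore) (i : ℕ) (steps : List (List ℕ × List ℕ)) : Bool :=
  List.rec (motive := fun _ => QStore → ℕ → Bool) (fun _ _ => true)
    (fun st _ ih S i => Bool.rec false (ih (S.ins d i st.1) (i + 1)) (rupQ S f (assumeQ st.1) st.2)) steps S i

/-! ## Soundness -/

/-- `F` is a sound falsified set for `σ`: every literal in `F` is false under `σ`. -/
def ConsF (σ : ℕ → Bool) (F : ℕ) : Prop := ∀ l, Nat.testBit F l = true → litTrue σ l = false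

/-- Adding a literal that is false under `σ`. -/
theorem consF_lor {σ : ℕ → Bool} {F : ℕ} (hF : ConsF σ F) {u : ℕ} (hu : litTrue σ u = false) :
    ConsF σ (Nat.lor F (Nat.pow 2 u)) := by
  intro l hl
  rw [show Nat.lor F (Nat.pow 2 u) = F ||| 2 ^ u from rfl, Nat.testBit_lor, Nat.testBit_two_pow] at hl
  rcases Bool.or_eq_true_iff.1 hl with h | h
  · exact hF l h
  · rw [decide_eq_true_eq] at h; exact h ▸ hu

/-- `scanQ F D = 0` means every literal of `D` is in `F`. -/
theorem scanQ_zero {F : ℕ} : ∀ {D : List ℕ}, scanQ F D = 0 → ∀ l ∈ D, Nat.testBit F l = true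
  | [], _, l, hl => by simp at hl
  | l₀ :: D, h, l, hl => by
      revert h
      change (Bool.rec (Bool.rec 1 (l₀ + 2) (Nat.beq (scanQ F D) 0)) (scanQ F D) (tb F l₀) : ℕ) = 0 → _
      rw [tb_eq_testBit]
      cases hb : Nat.testBit F l₀ <;> cases hz : Nat.beq (scanQ F D) 0 <;> intro h
      · exact absurd h (by change (1 : ℕ) ≠ 0; omega)
      · exact absurd h (by change l₀ + 2 ≠ 0; omega)
      · change scanQ F D = 0 at h
        rcases List.mem_cons.1 hl with rfl | hl
        · exact hb
        · exact scanQ_zero h l hl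
      · change scanQ F D = 0 at h
        rcases List.mem_cons.1 hl with rfl | hl
        · exact hb
        · exact scanQ_zero h l hl

/-- SOUNDNESS OF THE SCAN: for a clause true under `σ` and a sound falsified set, the scan does not report a conflict, and a
reported unit literal is true under `σ`. -/
theorem scanQ_sound {σ : ℕ → Bool} {F : ℕ} (hF : ConsF σ F) :
    ∀ (D : List ℕ), clauseTrue σ D = true → scanQ F D ≠ 0 ∧ ∀ u, scanQ F D = u + 2 → litTrue σ u = true
  | [], h => by simp [clauseTrue] at h
  | l :: D, h => by
      have hD : clauseTrue σ (l :: D) = (litTrue σ l || clauseTrue σ D) := by simp [clauseTrue]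
      rw [hD] at h
      have hs : scanQ F (l :: D) =
          (Bool.rec (Bool.rec 1 (l + 2) (Nat.beq (scanQ F D) 0)) (scanQ F D) (tb F l) : ℕ) := rfl
      rw [hs, tb_eq_testBit]
      cases hb : Nat.testBit F l
      · -- `l` is not falsified
        change (Bool.rec 1 (l + 2) (Nat.beq (scanQ F D) 0) : ℕ) ≠ 0 ∧
          ∀ u, (Bool.rec 1 (l + 2) (Nat.beq (scanQ F D) 0) : ℕ) = u + 2 → litTrue σ u = true
        cases hz : Nat.beq (scanQ F D) 0
        · change (1 : ℕ) ≠ 0 ∧ ∀ u, (1 : ℕ) = u + 2 → litTrue σ u = true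
          exact ⟨by omega, fun u hu => by omega⟩
        · change l + 2 ≠ 0 ∧ ∀ u, l + 2 = u + 2 → litTrue σ u = true
          refine ⟨by omega, fun u hu => ?_⟩
          have hu' : u = l := by omega
          subst hu'
          -- every literal of `D` is falsified, so `D` is false under `σ`, so the head literal is true
          have hz' : scanQ F D = 0 := Nat.eq_of_beq_eq_true hz
          cases hl : litTrue σ u
          · rw [hl, Bool.false_or] at h
            obtain ⟨x, hx, hxt⟩ := List.any_eq_true.1 h
            have := hF x (scanQ_zero hz' x hx)
            rw [this] at hxt
            exact absurd hxt Bool.false_ne_true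
          · rfl
      · -- `l` is falsified: the clause is true through `D`
        change scanQ F D ≠ 0 ∧ ∀ u, scanQ F D = u + 2 → litTrue σ u = true
        have hl : litTrue σ l = false := hF l hb
        rw [hl, Bool.false_or] at h
        exact scanQ_sound hF D h

/-- SOUNDNESS OF `rupQ`: from a sound falsified set, a successful run is impossible when every stored clause is true. -/
theorem rupQ_sound {σ : ℕ → Bool} {S : QStore} (hS : S.All fun C => clauseTrue σ C = true) :
    ∀ (f : ℕ) {F : ℕ}, ConsF σ F → ∀ (hs : List ℕ), rupQ S f F hs = true → False
  | 0, F, _, hs, h => by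
      change false = true at h
      exact Bool.false_ne_true h
  | f + 1, F, _, [], h => by
      change false = true at h
      exact Bool.false_ne_true h
  | f + 1, F, hF, hh :: hs, h => by
      have hr : rupQ S (f + 1) F (hh :: hs) = Option.casesOn (motive := fun _ => Bool) (S.get hh) false (fun D =>
          (Bool.rec (Bool.rec (rupQ S f (Nat.lor F (Nat.pow 2 (negQ (scanQ F D - 2)))) hs) false
            (Nat.beq (scanQ F D) 1)) true (Nat.beq (scanQ F D) 0) : Bool)) := rfl
      rw [hr] at h
      cases hget : S.get hh with
      | none => rw [hget] at h; exact Bool.false_ne_true h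
      | some D =>
          rw [hget] at h
          change (Bool.rec (Bool.rec (rupQ S f (Nat.lor F (Nat.pow 2 (negQ (scanQ F D - 2)))) hs) false
            (Nat.beq (scanQ F D) 1)) true (Nat.beq (scanQ F D) 0) : Bool) = true at h
          have hD := QStore.All.get hS hget
          obtain ⟨h0, hu⟩ := scanQ_sound hF D hD
          cases hz : Nat.beq (scanQ F D) 0
          · rw [hz] at h
            change (Bool.rec (rupQ S f (Nat.lor F (Nat.pow 2 (negQ (scanQ F D - 2)))) hs) false
              (Nat.beq (scanQ F D) 1) : Bool) = true at h
            cases h1 : Nat.beq (scanQ F D) 1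
            · rw [h1] at h
              change rupQ S f (Nat.lor F (Nat.pow 2 (negQ (scanQ F D - 2)))) hs = true at h
              have hne0 : scanQ F D ≠ 0 := h0
              have hne1 : scanQ F D ≠ 1 := fun e => by
                rw [e] at h1; exact Bool.false_ne_true (h1.symm.trans (by rfl))
              have h2 : scanQ F D = (scanQ F D - 2) + 2 := by omega
              have hut : litTrue σ (scanQ F D - 2) = true := hu _ h2
              have hneg : litTrue σ (negQ (scanQ F D - 2)) = false := by
                rw [negQ_eq_neg, litTrue_neg, hut]; rfl
              exact rupQ_sound hS f (consF_lor hF hneg) hs h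
            · rw [h1] at h
              exact Bool.false_ne_true h
          · exact h0 (Nat.eq_of_beq_eq_true hz)

/-- Assuming the negation of a clause false under `σ` gives a sound falsified set. -/
theorem consF_assumeQ {σ : ℕ → Bool} : ∀ (C : List ℕ), clauseTrue σ C = false → ConsF σ (assumeQ C)
  | [], _ => fun l hl => by
      change Nat.testBit 0 l = true at hl
      simp at hl
  | l :: C, h => by
      have hC : clauseTrue σ (l :: C) = (litTrue σ l || clauseTrue σ C) := by simp [clauseTrue]
      rw [hC, Bool.or_eq_false_iff] at h
      have ha : assumeQ (l :: C) = Nat.lor (assumeQ C) (Nat.pow 2 l) := rfl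
      rw [ha]
      exact consF_lor (consF_assumeQ C h.2) h.1

/-- SOUNDNESS OF `checkAllQ`: if every stored clause is true under `σ`, every checked clause is true under `σ`. -/
theorem checkAllQ_sound {σ : ℕ → Bool} (f d : ℕ) :
    ∀ (steps : List (List ℕ × List ℕ)) {S : QStore} (i : ℕ), (S.All fun C => clauseTrue σ C = true) →
      checkAllQ f d S i steps = true → ∀ C ∈ steps.map Prod.fst, clauseTrue σ C = true
  | [], S, i, _, _, C, hC => by simp at hC
  | (C₀, hs) :: rest, S, i, hS, h, C, hC => by
      have hc : checkAllQ f d S i ((C₀, hs) :: rest) =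
          (Bool.rec false (checkAllQ f d (S.ins d i C₀) (i + 1) rest) (rupQ S f (assumeQ C₀) hs) : Bool) := rfl
      rw [hc] at h
      cases hr : rupQ S f (assumeQ C₀) hs
      · rw [hr] at h
        exact absurd h Bool.false_ne_true
      · rw [hr] at h
        change checkAllQ f d (S.ins d i C₀) (i + 1) rest = true at h
        have hC₀ : clauseTrue σ C₀ = true := by
          by_contra hf
          simp only [Bool.not_eq_true] at hf
          exact rupQ_sound hS f (consF_assumeQ C₀ hf) hs hr
        simp only [List.map_cons, List.mem_cons] at hC
        rcases hC with rfl | hC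
        · exact hC₀
        · exact checkAllQ_sound f d rest (i + 1) (QStore.All.ins hC₀ d S hS i) h C (by simpa using hC)

/-- A checked step list containing the EMPTY clause refutes `σ`. -/
theorem checkAllQ_refutes {σ : ℕ → Bool} {f d : ℕ} {S : QStore} {i : ℕ} {steps : List (List ℕ × List ℕ)}
    (hS : S.All fun C => clauseTrue σ C = true) (h : checkAllQ f d S i steps = true)
    (hnil : [] ∈ steps.map Prod.fst) : False := by
  have := checkAllQ_sound f d steps i hS h [] hnil
  simp [clauseTrue] at this

end Summit.Ventures.DiscreteObjects.UnitDistance.KRup
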